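import Summits.ResolutionOfSingularities.ResolutionOfSingularities.Theorems.FrobeniusClosingSteerEventualMonomial
import Summits.ResolutionOfSingularities.ResolutionOfSingularities.Theorems.FrobeniusClosingSteerSwitchingSetup
import Summits.ResolutionOfSingularities.ResolutionOfSingularities.Theorems.FrobeniusClosingSteerCore4SteeredRunExists
import Summits.ResolutionOfSingularities.ResolutionOfSingularities.Theorems.FrobeniusClosingSteerCore4DictionaryLeaf
import Summits.ResolutionOfSingularities.ResolutionOfSingularities.Theorems.FrobeniusClosingSteerClosedPointDictionary
import HarnessLib

/-!
# Crux `Steer` (stmt-ResolutionOfSingularities-16345), line `switching_dichotomy` (skeleton r21/r22 §F, res-L0-w41-strat-1's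
# alternative decomposition `ss-monomial-cycles` of the (α) heart Φ3ᴸˢ + Φ4ᴸˢ): **S2 `MonomialStageTrichotomy`** — the
# trichotomy at a MONOMIAL stage (toroidal exit ∨ order-one exit ∨ monomial cycle step)

OURS (campaign `res-hironaka`, rung L ★L-G4, slot W4.1; seat res-type-028 on res-L0-w41-plan-1's NAMING 06:00:24Z «028:
S2»; Theses-free, def-free helper for the holder res-L0-w41-lead-1; NOT a statement of the manuscript under review
[claim: Hironaka2017, status: under-review]; AI-produced, weaker than expert review).

STATEMENT (res-L0-w41-strat-1's `MonomialStageTrichotomy`, `line-ss-monomial-cycles.lean` c94e4ea68bbafa85 = r22 §F, with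
`GenAt` / `MonomialAt` / `CycleStepAt` / `LogExitAt` / `LogFinalAt` / `ContentInvertible` / `ToroidalAt` / `ExitAt` /
`OrderOneGen` / `IsFracOf` UNFOLDED, and of `CoreDatum` only the conjuncts used — `t ^ p ∈ A₀`, regularity of the base at
the centre, `ZeroDim`, «`t ^ p` is not a `p`-th power at the centre» — kept as binders, so that the skeleton leaf is an
`exact`): along the point sequence `R` of the base from `locAtCentre A₀ O`, at a member `S = R M` carrying a generator
`s` of the torsor of `t` (`s ^ p ∈ S`, `t ∈ S[s]`) whose radicand is an rsop-monomial times a unit,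
`s ^ p = ∏ z_l ^ m_l · u`, EITHER the member is log-final (some `m_l ≢ 0 (mod p)`: `s ^ p` is toroidal with an exponent
prime to `p` and `s ∉ Frac A₀` — Giraud's normal form, the E2 disjunct), OR some generator is in order-one form, OR a
MONOMIAL CYCLE STEP `s = μ (s₁ + c)` starts: `μ = ∏ z_l ^ (m_l / p)` (all `m_l ≡ 0`), `c` a unit `p`-th root of `u`
modulo `𝔪_S` (the residue field of a member is algebraic over the perfect `k`, hence perfect), `s₁ = s / μ − c ≠ 0` a new
generator with radicand `s₁ ^ p = u − c ^ p ∈ 𝔪_S`. (In the second case the proof in fact always produces the cycle step;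
the order-one disjunct is carried for the registered shape.)

Ingredients, all in the tree: res-L0-w41-stub-4's `EventualMonomial.prod_pow_eq_pow_of_forall_dvd` (p501382), the
sequence bookkeeping `sequence_dominates` / `sequence_monotone` / `sequence_le_subfield`, res-D-pv-012's `SteeredRun.not_mem_closure_of_ne_pow` («`t ∉ Frac A₀`», p499045) and
`Core4Dictionary.exists_eval₂_residue_eq_zero` (residues algebraic over `k`), res-L0-w41-stub-2's
`ClosedPointDictionary.exists_pow_eq_residue_of_perfectField` (p503434), Mathlib's `Algebra.IsAlgebraic.perfectField`,
`sub_pow_char`. Sources of the mathematics: the `p`-th power cleaning of [CossartPiltant2019, §2] at a monomial radicand;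
[Posva2023, (4.0.1.j)]; HLOST [HeinzerEtAl2015, Prop. 4.4].
-/

-- `Summit.<S>.<S>.…` duplicates the summit name by design (single-problem summit).
set_option linter.dupNamespace false

open IsLocalRing
open Literature.AlgebraicGeometry.Resolution

namespace Summit.ResolutionOfSingularities.ResolutionOfSingularities.Theorems.SwitchingDichotomy

namespace MonomialStage

variable {k K : Type} [Field k] [Field K] [Algebra k K]

/-! ## Small bookkeeping lemmas -/

/-- In a local subring `S ⊆ O` dominated by `O` (`𝔪_S` = the elements of value `< 1`), a unit has value `1`.
[folklore] -/
theorem valuation_eq_one_of_isUnit {O : ValuationSubring K} {S : Subring K} [IsLocalRing S]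
    (hdom : SubringDominates S O.toSubring) {u : S} (hu : IsUnit u) : O.valuation (u : K) = 1 := by
  have hSO : S ≤ O.toSubring := hdom.1
  have hle : O.valuation (u : K) ≤ 1 := (O.valuation_le_one_iff _).mpr (hSO u.2)
  rcases hle.lt_or_eq with hlt | heq
  · exact absurd (((subringDominates_valuationSubring_iff hSO).mp hdom u).mpr hlt)
      (fun hm => (IsLocalRing.mem_maximalIdeal _).mp hm hu)
  · exact heq

/-- In a local subring `S ⊆ O` dominated by `O`, an element of the maximal ideal has value `< 1`. [folklore] -/
theorem valuation_lt_one_of_mem_maximalIdeal {O : ValuationSubring K} {S : Subring K} [IsLocalRing S]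
    (hdom : SubringDominates S O.toSubring) {a : S} (ha : a ∈ maximalIdeal S) : O.valuation (a : K) < 1 :=
  ((subringDominates_valuationSubring_iff hdom.1).mp hdom a).mp ha

/-- In a local subring `S ⊆ O` dominated by `O`, an element of value `< 1` lies in the maximal ideal. [folklore] -/
theorem mem_maximalIdeal_of_valuation_lt_one {O : ValuationSubring K} {S : Subring K} [IsLocalRing S]
    (hdom : SubringDominates S O.toSubring) {a : S} (ha : O.valuation (a : K) < 1) : a ∈ maximalIdeal S :=
  ((subringDominates_valuationSubring_iff hdom.1).mp hdom a).mpr ha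

/-- **The residue field of a member is PERFECT.** For a local subring `S ⊆ O` dominated by `O`, containing the image of
the perfect ground field `k`, with `O` zero-dimensional over `k` (every element of `O` is a root modulo `𝔪_O` of a
non-zero polynomial over `k`): the residue field of `S` is algebraic over `k`, hence perfect
(`Algebra.IsAlgebraic.perfectField`). [cite: ZariskiSamuel1960, Ch. VI §17] [folklore] -/
theorem perfectField_residueField {O : ValuationSubring K} {S : Subring K} [IsLocalRing S] [PerfectField k]
    (hzd : ∀ x ∈ O, ∃ f : Polynomial k, f ≠ 0 ∧ Polynomial.aeval (R := k) x f ∈ O.nonunits)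
    (hdom : SubringDominates S O.toSubring) (hk : ∀ c : k, algebraMap k K c ∈ S) :
    PerfectField (ResidueField S) := by
  let kS : k →+* S := (algebraMap k K).codRestrict S hk
  letI : Algebra k (ResidueField S) := ((residue S).comp kS).toAlgebra
  haveI : Algebra.IsAlgebraic k (ResidueField S) := by
    refine ⟨fun z => ?_⟩
    obtain ⟨f, hf0, hf⟩ := Core4Dictionary.exists_eval₂_residue_eq_zero O hzd S.subtype (fun y => hdom.1 y.2)
      (fun y hy => mem_maximalIdeal_of_valuation_lt_one hdom hy) kS (fun c => rfl) z
    exact ⟨f, hf0, hf⟩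
  exact Algebra.IsAlgebraic.perfectField k

/-- **A unit `p`-th root modulo `𝔪`.** In a local ring of prime characteristic `p` with perfect residue field, every
unit `u` has a unit `c` with `u − c ^ p ∈ 𝔪`. [folklore] -/
theorem exists_isUnit_sub_pow_mem_maximalIdeal {S : Type} [CommRing S] [IsLocalRing S] (p : ℕ) [Fact p.Prime]
    [CharP S p] [PerfectField (ResidueField S)] {u : S} (hu : IsUnit u) :
    ∃ c : S, IsUnit c ∧ u - c ^ p ∈ maximalIdeal S := by
  obtain ⟨b, hb⟩ := ClosedPointDictionary.exists_pow_eq_residue_of_perfectField p (residue S u)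
  obtain ⟨c, rfl⟩ := IsLocalRing.residue_surjective b
  refine ⟨c, ?_, ?_⟩
  · by_contra hc
    have hc0 : residue S c = 0 := (IsLocalRing.residue_eq_zero_iff c).mpr ((IsLocalRing.mem_maximalIdeal _).mpr hc)
    have hu0 : residue S u = 0 := by rw [← hb, hc0, zero_pow (Fact.out : p.Prime).ne_zero]
    exact (IsLocalRing.residue_ne_zero_iff_isUnit u).mpr hu hu0
  · rw [← IsLocalRing.residue_eq_zero_iff, map_sub, map_pow, hb, sub_self]

/-- Closure monotonicity used twice: if `s ∈ S[s₁]` then `S[s] ⊆ S[s₁]`. [folklore] -/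
theorem closure_insert_le_of_mem {S : Subring K} {s s₁ : K} (h : s ∈ Subring.closure (insert s₁ (S : Set K))) :
    Subring.closure (insert s (S : Set K)) ≤ Subring.closure (insert s₁ (S : Set K)) :=
  Subring.closure_le.mpr (Set.insert_subset h
    ((Set.subset_insert _ _).trans Subring.subset_closure))

/-! ## S2 — the trichotomy at a monomial stage -/

/-- **S2 `MonomialStageTrichotomy`** (res-L0-w41-strat-1's statement, `GenAt`/`MonomialAt`/`CycleStepAt`/`LogExitAt`/
`ExitAt` unfolded; of `CoreDatum` only `t ^ p ∈ A₀`, regularity at the centre, `ZeroDim` and «`t ^ p` not a `p`-th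
power at the centre» are used). At a member `R M` of the point sequence carrying a generator `s` of the torsor of `t`
whose radicand `s ^ p` is an rsop-monomial times a unit: log-final (toroidal with an exponent prime to `p`, `s ∉ Frac A₀`)
∨ order-one exit ∨ a monomial cycle step `s = μ (s₁ + c)`. [cite: CossartPiltant2019, §2] [cite: HeinzerEtAl2015, Prop. 4.4]
[folklore] -/
theorem monomialStage_trichotomy (p : ℕ) (hp : p.Prime) [CharP k p] [PerfectField k]
    (O : ValuationSubring K) (A₀ : Subalgebra k K) (h₀ : A₀.toSubring ≤ O.toSubring) (t : K)
    (htp : t ^ p ∈ A₀)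
    (hreg : IsRegularLocalRing (Localization.AtPrime
      (Ideal.comap (Subring.inclusion h₀) (IsLocalRing.maximalIdeal O))))
    (hzd : ∀ x ∈ O, ∃ f : Polynomial k, f ≠ 0 ∧ Polynomial.aeval (R := k) x f ∈ O.nonunits)
    (hc : ∀ c : Localization.AtPrime (Ideal.comap (Subring.inclusion h₀) (IsLocalRing.maximalIdeal O)),
      algebraMap A₀.toSubring (Localization.AtPrime (Ideal.comap (Subring.inclusion h₀)
        (IsLocalRing.maximalIdeal O))) ⟨t ^ p, htp⟩ ≠ c ^ p)
    (R : ℕ → Subring K) (hR0 : R 0 = locAtCentre A₀.toSubring O)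
    (hstep : ∀ i, IsQuadraticTransformAlong O (R i) (R (i + 1)))
    (M : ℕ) (s : K) (hgen : s ^ p ∈ R M ∧ t ∈ Subring.closure (insert s (R M : Set K)))
    (hmono : ∃ (_ : IsLocalRing (R M)), ∃ (n : ℕ) (z : Fin n → R M), IsRsopPart z ∧
      ∃ (m : Fin n → ℕ) (u : R M), IsUnit u ∧ s ^ p = (∏ l, ((z l : R M) : K) ^ m l) * (u : K)) :
    (∃ (_ : IsLocalRing (R M)),
      ((∃ f' : R M, (f' : K) = t ^ p ∧
          ∃ h : R M, h ≠ 0 ∧ (∀ δ : Derivation ℤ (R M) (R M), h ∣ δ f') ∧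
            ∃ (δ : Derivation ℤ (R M) (R M)) (u : R M), IsUnit u ∧ δ f' = h * u) ∨
        (∃ t₂ : K, ¬ (∃ y ∈ A₀, ∃ z ∈ A₀, z ≠ 0 ∧ t₂ = y / z) ∧
          ∃ (n : ℕ) (z : Fin n → R M), IsRsopPart z ∧ ∃ (m : Fin n → ℕ), (∃ l, ¬ p ∣ m l) ∧
            ∃ u : R M, IsUnit u ∧ t₂ ^ p = (∏ l, ((z l : R M) : K) ^ m l) * (u : K)))) ∨
    (∃ s' : K, (s' ^ p ∈ R M ∧ t ∈ Subring.closure (insert s' (R M : Set K))) ∧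
      ∃ g ∈ R M, ∃ (_ : IsLocalRing (R M)) (z : Fin 1 → R M), IsRsopPart z ∧
        ((z 0 : R M) : K) = s' ^ p - g ^ p) ∨
    ∃ s₁ μ c : K, μ ∈ R M ∧ c ∈ R M ∧
      (∃ (_ : IsLocalRing (R M)), ∃ (n : ℕ) (z : Fin n → R M), IsRsopPart z ∧
        ∃ (m : Fin n → ℕ) (u : R M), IsUnit u ∧ μ = (∏ l, ((z l : R M) : K) ^ m l) * (u : K)) ∧
      O.valuation c = 1 ∧ s = μ * (s₁ + c) ∧ s₁ ≠ 0 ∧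
      (s₁ ^ p ∈ R M ∧ t ∈ Subring.closure (insert s₁ (R M : Set K))) ∧ O.valuation (s₁ ^ p) < 1 ∧
      (O.valuation (s ^ p) < 1 → O.valuation μ < 1) := by
  classical
  set S : Subring K := R M with hSdef
  haveI : Fact p.Prime := ⟨hp⟩
  haveI : CharP K p := charP_of_injective_algebraMap (algebraMap k K).injective p
  obtain ⟨hS, n, z, hz, m, u, hu, hsp⟩ := hmono
  -- facts along the sequence: domination by `O`, monotonicity, members inside `Frac A₀`
  have hdom0 : SubringDominates (R 0) O.toSubring := by
    rw [hR0]
    exact subringDominates_locAtCentre h₀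
  have hdom : SubringDominates S O.toSubring := (sequence_dominates hdom0 hstep M).1
  have hSO : S ≤ O.toSubring := hdom.1
  have hmonoR : Monotone R := sequence_monotone hstep
  set F : Subfield K := Subfield.closure (A₀ : Set K) with hF
  have hF0 : R 0 ≤ F.toSubring := by
    rw [hR0]
    exact locAtCentre_le_subfield O fun x hx => Subfield.subset_closure hx
  have hSF : (S : Set K) ⊆ F := fun x hx => sequence_le_subfield hF0 hstep M hx
  -- `t ∉ Frac A₀`
  have htF : t ∉ F := SteeredRun.not_mem_closure_of_ne_pow O A₀ h₀ hp.ne_zero t htp hreg hc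
  -- a generator over `S` is never a fraction of `A₀` (else `t ∈ S[s] ⊆ Frac A₀`)
  have hgenF : ∀ s' : K, t ∈ Subring.closure (insert s' (S : Set K)) → s' ∉ F := by
    intro s' ht hs'
    refine htF ((Subring.closure_le (t := F.toSubring)).mpr ?_ ht)
    exact Set.insert_subset hs' hSF
  have hsF : s ∉ F := hgenF s hgen.2
  by_cases hdiv : ∃ l, ¬ p ∣ m l
  · -- CASE A: some exponent prime to `p` — the member is log-final (E2, Giraud's normal form) with `t₂ := s`
    refine Or.inl ⟨hS, Or.inr ⟨s, fun hfrac => hsF ((exists_div_iff_mem_closure A₀ s).mp hfrac), n, z, hz, m, hdiv,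
      u, hu, hsp⟩⟩
  · -- CASE B: all exponents divisible by `p` — a monomial cycle step
    simp only [not_exists, not_not] at hdiv
    -- the `p`-th root `μ` of the monomial part
    set μS : S := ∏ l, z l ^ (m l / p) with hμS
    have hμp : (∏ l, ((z l : S) : K) ^ m l) = ((μS : S) : K) ^ p :=
      EventualMonomial.prod_pow_eq_pow_of_forall_dvd z hdiv
    have hμ0 : ((μS : S) : K) ≠ 0 := by
      rw [hμS]
      push_cast
      exact Finset.prod_ne_zero_iff.mpr fun l _ => pow_ne_zero _ fun h0 => hz.ne_zero l (Subtype.ext h0)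
    -- perfect residue field of `S`, and a unit `p`-th root `c` of `u` modulo `𝔪_S`
    haveI hreg' : IsRegularLocalRing S := hz.isRegularLocalRing
    have hk : ∀ c : k, algebraMap k K c ∈ S := fun c =>
      hmonoR (Nat.zero_le M) (by rw [hR0]; exact le_locAtCentre _ O (A₀.algebraMap_mem c))
    haveI : PerfectField (ResidueField S) := perfectField_residueField hzd hdom hk
    obtain ⟨c, hcu, hcm⟩ := exists_isUnit_sub_pow_mem_maximalIdeal (S := S) p hu
    -- the new generator
    set s₁ : K := s / (μS : K) - (c : K) with hs₁
    have hs : s = (μS : K) * (s₁ + (c : K)) := by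
      rw [hs₁, sub_add_cancel, mul_div_cancel₀ _ hμ0]
    have hs₁p : s₁ ^ p = ((u - c ^ p : S) : K) := by
      have hprod0 : (∏ l, ((z l : S) : K) ^ m l) ≠ 0 := by
        rw [hμp]; exact pow_ne_zero _ hμ0
      have h1 : (s / (μS : K)) ^ p = ((u : S) : K) := by
        rw [div_pow, ← hμp, hsp, mul_div_cancel_left₀ _ hprod0]
      rw [hs₁, sub_pow_char, h1]
      push_cast
      ring
    have hs₁S : s₁ ^ p ∈ S := by rw [hs₁p]; exact SetLike.coe_mem _
    -- `t ∈ S[s₁]` because `s = μ (s₁ + c) ∈ S[s₁]`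
    have hsmem : s ∈ Subring.closure (insert s₁ (S : Set K)) := by
      rw [hs]
      refine Subring.mul_mem _ (Subring.subset_closure (Set.mem_insert_of_mem _ μS.2))
        (Subring.add_mem _ (Subring.subset_closure (Set.mem_insert _ _))
          (Subring.subset_closure (Set.mem_insert_of_mem _ c.2)))
    have ht₁ : t ∈ Subring.closure (insert s₁ (S : Set K)) := closure_insert_le_of_mem hsmem hgen.2
    -- `s₁ ≠ 0`: otherwise `s = μ c ∈ S ⊆ Frac A₀` and `t ∈ S[s] ⊆ Frac A₀`
    have hs₁0 : s₁ ≠ 0 := by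
      intro h0
      apply hsF
      have : s ∈ S := by
        rw [hs, h0, zero_add]
        exact S.mul_mem μS.2 c.2
      exact hSF this
    -- values
    have hvc : O.valuation (c : K) = 1 := valuation_eq_one_of_isUnit hdom hcu
    have hvu : O.valuation ((u : S) : K) = 1 := valuation_eq_one_of_isUnit hdom hu
    have hvs₁ : O.valuation (s₁ ^ p) < 1 := by
      rw [hs₁p]
      exact valuation_lt_one_of_mem_maximalIdeal hdom hcm
    have hvμ : O.valuation (s ^ p) < 1 → O.valuation ((μS : S) : K) < 1 := by
      intro hlt
      rw [hsp, hμp, map_mul, map_pow, hvu, mul_one] at hlt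
      by_contra hge
      have h1 : O.valuation ((μS : S) : K) = 1 :=
        le_antisymm ((O.valuation_le_one_iff _).mpr (hSO μS.2)) (not_lt.mp hge)
      rw [h1, one_pow] at hlt
      exact lt_irrefl _ hlt
    refine Or.inr (Or.inr ⟨s₁, (μS : K), (c : K), μS.2, c.2, ⟨hS, n, z, hz, fun l => m l / p, 1, isUnit_one, ?_⟩,
      hvc, hs, hs₁0, ⟨hs₁S, ht₁⟩, hvs₁, hvμ⟩)
    rw [hμS]
    push_cast
    rw [mul_one]

end MonomialStage

end Summit.ResolutionOfSingularities.ResolutionOfSingularities.Theorems.SwitchingDichotomy
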